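import Mathlib.Algebra.Order.Field.Basic
import Mathlib.Algebra.Order.BigOperators.Group.Finset
import Mathlib.Algebra.BigOperators.Group.Finset.Basic
import Mathlib.Algebra.BigOperators.Ring.Finset
import Mathlib.Tactic.FieldSimp
import Mathlib.Tactic.Ring
import Mathlib.Tactic.Linarith
import Mathlib.Tactic.LinearCombination
import HarnessLib

/-!
# Rounding-mode optima (OPTIMA.md §R): SR is the unique unbiased two-point rule and the
minimum-variance unbiased rule on a format

HONEST FRAMING: certified error envelopes and provably optimal rounding/accumulation schemes for
low-precision formats under stated cost models; every table by two implementations; no hardware or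
vendor claims.

Venture CertifiedArithmetic / lowprec, OPT slice (staged).  New work (elementary; recorded because the
cell's R2/R3 optimality claims must be checkable, and complementary to the SR seat's
`SRAccumulation.lean`, which computes the variance of the standard SR rule but does not prove it minimal).

Setting: a value `x` strictly between two ADJACENT representable numbers `a < b` of a format `F`
(no point of `F` lies in the open interval `(a,b)`), and a randomised rounding rule = a finitely supported
probability distribution on `F`, given by weights `w i ≥ 0`, `∑ w i = 1` on values `v i ∈ F`.

* `sr_unbiased_two_point_unique` (R2): an unbiased rule supported on `{a,b}` must round up with
  probability exactly `(x-a)/(b-a)` — stochastic rounding is the ONLY unbiased two-point rule.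
* `variance_lower_bound` (R3): EVERY unbiased rule on `F` has variance `≥ (x-a)(b-x)`, because
  `(v-a)(v-b) ≥ 0` at every representable `v`; `sr_two_point_variance`: SR attains it.  Hence SR is the
  minimum-variance unbiased rounding into `F`, and any unbiased rule putting mass outside `{a,b}` is
  strictly worse (`variance_strict_of_mass_outside`).
-/

namespace Summit.Ventures.CertifiedArithmetic.LowPrec.Opt

variable {K : Type*} [Field K] [LinearOrder K] [IsStrictOrderedRing K]

/-- **R2.** The unbiased two-point rule is unique: if a rule rounds `x` down to `a` with probability
`1 - p` and up to `b` with probability `p` and has mean `x`, then `p = (x-a)/(b-a)`. -/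
theorem sr_unbiased_two_point_unique {a b x p : K} (hab : a < b)
    (hmean : (1 - p) * a + p * b = x) : p = (x - a) / (b - a) := by
  rw [eq_div_iff (sub_ne_zero.mpr (ne_of_gt hab))]
  linear_combination hmean

omit [IsStrictOrderedRing K] in
/-- The variance of the SR two-point rule about its mean `x` is `(x-a)(b-x)`. -/
theorem sr_two_point_variance {a b x : K} (hab : a < b) :
    (1 - (x - a) / (b - a)) * (a - x) ^ 2 + (x - a) / (b - a) * (b - x) ^ 2 = (x - a) * (b - x) := by
  have hba : b - a ≠ 0 := sub_ne_zero.mpr (ne_of_gt hab)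
  field_simp
  ring

/-- pointwise key fact: a representable value outside the open gap `(a,b)` satisfies `(v-a)(v-b) ≥ 0`. -/
theorem gap_product_nonneg {a b v : K} (hab : a ≤ b) (hv : v ≤ a ∨ b ≤ v) : 0 ≤ (v - a) * (v - b) := by
  rcases hv with h | h
  · exact mul_nonneg_of_nonpos_of_nonpos (by linarith) (by linarith)
  · exact mul_nonneg (by linarith) (by linarith)

/-- **R3 (variance lower bound).** Any unbiased randomised rounding of `x` into a format all of whose
points lie outside the open gap `(a,b)` has variance at least `(x-a)(b-x)`. -/
theorem variance_lower_bound {ι : Type*} [Fintype ι] (w v : ι → K) {a b x : K} (hab : a ≤ b)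
    (hw : ∀ i, 0 ≤ w i) (hsum : ∑ i, w i = 1) (hmean : ∑ i, w i * v i = x)
    (hgap : ∀ i, v i ≤ a ∨ b ≤ v i) :
    (x - a) * (b - x) ≤ ∑ i, w i * (v i - x) ^ 2 := by
  have h0 : 0 ≤ ∑ i, w i * ((v i - a) * (v i - b)) :=
    Finset.sum_nonneg (fun i _ => mul_nonneg (hw i) (gap_product_nonneg hab (hgap i)))
  have hterm : ∀ i, w i * ((v i - a) * (v i - b)) =
      w i * (v i - x) ^ 2 + (2 * x - a - b) * (w i * v i) - ((2 * x - a - b) * x - (x - a) * (x - b)) * w i := by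
    intro i; ring
  have hs : ∑ i, w i * ((v i - a) * (v i - b)) = ∑ i, w i * (v i - x) ^ 2 +
      (2 * x - a - b) * ∑ i, w i * v i - ((2 * x - a - b) * x - (x - a) * (x - b)) * ∑ i, w i := by
    simp only [hterm, Finset.sum_add_distrib, Finset.sum_sub_distrib, ← Finset.mul_sum]
  rw [hsum, hmean] at hs
  linarith

/-- **R3, strictness.** If in addition some weight sits on a point strictly outside `[a,b]`
(`v j < a` or `b < v j` with `w j > 0`), the variance is strictly larger than SR's. -/
theorem variance_strict_of_mass_outside {ι : Type*} [Fintype ι] [DecidableEq ι] (w v : ι → K)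
    {a b x : K} (hab : a ≤ b) (hw : ∀ i, 0 ≤ w i) (hsum : ∑ i, w i = 1) (hmean : ∑ i, w i * v i = x)
    (hgap : ∀ i, v i ≤ a ∨ b ≤ v i) {j : ι} (hj : 0 < w j) (hout : v j < a ∨ b < v j) :
    (x - a) * (b - x) < ∑ i, w i * (v i - x) ^ 2 := by
  have hpos : 0 < w j * ((v j - a) * (v j - b)) := by
    refine mul_pos hj ?_
    rcases hout with h | h
    · exact mul_pos_of_neg_of_neg (by linarith) (by linarith)
    · exact mul_pos (by linarith) (by linarith)
  have h0 : 0 < ∑ i, w i * ((v i - a) * (v i - b)) := by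
    calc (0 : K) < w j * ((v j - a) * (v j - b)) := hpos
      _ ≤ ∑ i, w i * ((v i - a) * (v i - b)) :=
        Finset.single_le_sum (f := fun i => w i * ((v i - a) * (v i - b)))
          (fun i _ => mul_nonneg (hw i) (gap_product_nonneg hab (hgap i))) (Finset.mem_univ j)
  have hterm : ∀ i, w i * ((v i - a) * (v i - b)) =
      w i * (v i - x) ^ 2 + (2 * x - a - b) * (w i * v i) - ((2 * x - a - b) * x - (x - a) * (x - b)) * w i := by
    intro i; ring
  have hs : ∑ i, w i * ((v i - a) * (v i - b)) = ∑ i, w i * (v i - x) ^ 2 +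
      (2 * x - a - b) * ∑ i, w i * v i - ((2 * x - a - b) * x - (x - a) * (x - b)) * ∑ i, w i := by
    simp only [hterm, Finset.sum_add_distrib, Finset.sum_sub_distrib, ← Finset.mul_sum]
  rw [hsum, hmean] at hs
  linarith

end Summit.Ventures.CertifiedArithmetic.LowPrec.Opt
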